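import Summits.BirchSwinnertonDyer.BirchSwinnertonDyer.Theorems.PrintCFramAwayBinderCriterion
import HarnessLib

/-!
# Route PrintCFram, crux C1: the away binder of the `3`-frame is EQUIVALENT to the congruence on the
# Mordell coefficient (sixth-power-free normal form) — regime N versus V is decidable by name
# (cell `bsd-print-cfram`, seat p4 g3; supports stmt-BirchSwinnertonDyer-20698)

HONEST FRAMING (cell `bsd-print-cfram`, run/shared/lean/pub/bsd-print-cfram/, D-0131 (2) print
tier; verbatim in every file of the seat): the cell works the partition leaf
`CornerF ∧ p ramified in the CM field K` (LADDER-BSD row K7r = B13; W-ALL row 12r) in PARTITION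
currency — a leaf or a cell counts only when its theorem is in the kernel BY NAME. Nothing is
closed here. CAPSTONE of `Theorems/PrintCFramAwayBinderCriterion.lean` (p553346): for ANY model `W`
of `y² = x³ + k` with `k` a SIXTH-POWER-FREE non-zero integer (the normal form every `j = 0` class
has), ty2's away binder
`hℓ : ∀ ℓ ≠ 3 prime, √−3 ∈ ℚ_ℓ → W bad at ℓ → W(ℚ_ℓ)[3] = 0`
holds IF AND ONLY IF for every prime `ℓ ≡ 1 (mod 3)` dividing `k`, `v_ℓ(k)` is odd or
`k/ℓ^{v_ℓ(k)}` is a non-residue mod `ℓ` (`away_binder_iff_congruence_of_sixthPowerFree`): «⟸» is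
p553346's `away_binder_of_mordell_model`; «⟹» is its V-witness `vWitness_of_mordell_model` at a
violating prime (`1 ≤ v_ℓ(k) ≤ 5` by sixth-power-freeness). Together with p546152 (the `ℚ₃`-torsion
pair criterion) the planner's regime letter N / V of a `j = 0` class is a pair of DECIDABLE congruences
on `k`, by name, for every class at once. Theorems only; no named fact. beyond-print: NO.

References: `Theorems/PrintCFramAwayBinderCriterion.lean`; [cite: SilvermanAEC2009, Exercise 3.7 and VII.5 Prop. 5.1];
[cite: SilvermanATAEC1994, IV.9.4 and Table 4.1]; [cite: Serre1973, Ch. II §3.3 Thm 3].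
-/

set_option linter.dupNamespace false
set_option autoImplicit false

noncomputable section

open scoped Classical
open WeierstrassCurve Literature.NumberTheory.EllipticCurves
  Literature.NumberTheory.EllipticCurves.Rank1Residual
  Summit.BirchSwinnertonDyer.Rank1Residual Summit.BirchSwinnertonDyer.Rank1Residual.X12

namespace Summit.BirchSwinnertonDyer.BirchSwinnertonDyer.Theorems.PrintCFram

/-- **Failure of the congruence produces a V-witness** (any elliptic model, `k` sixth-power-free at the
primes `ℓ ≡ 1 (mod 3)`): if some prime `ℓ ≡ 1 (mod 3)` divides `k` with `v_ℓ(k)` even and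
`k/ℓ^{v_ℓ(k)}` a residue, then `W` is bad at `ℓ` and `W(ℚ_ℓ)[3] ≠ 0`.
[cite: SilvermanATAEC1994, IV.9.4 and Table 4.1] [cite: SilvermanAEC2009, Exercise 3.7] -/
theorem exists_vWitness_of_not_congruence (W : WeierstrassCurve ℚ) [W.IsElliptic]
    {C : VariableChange ℚ} {k : ℤ} (hk : k ≠ 0) (hW : C • W = mordellCurve ((k : ℤ) : ℚ))
    (h6 : ∀ ℓ : ℕ, ℓ.Prime → ℓ % 3 = 1 → ¬ (ℓ : ℤ) ^ 6 ∣ k)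
    (hnot : ¬ ∀ ℓ : ℕ, ℓ.Prime → (ℓ : ℤ) ∣ k → ℓ % 3 = 1 →
      Odd (padicValInt ℓ k) ∨ ¬ IsSquare (((k / (ℓ : ℤ) ^ padicValInt ℓ k : ℤ)) : ZMod ℓ)) :
    ∃ (ℓ : ℕ) (_ : Fact ℓ.Prime), ℓ % 3 = 1 ∧ ¬ Good W ℓ ∧
      ∃ Q : (W.baseChange ℚ_[ℓ]).toAffine.Point, (3 : ℕ) • Q = 0 ∧ Q ≠ 0 := by
  push Not at hnot
  obtain ⟨ℓ, hℓP, hℓk, hℓ1, heven, hsq⟩ := hnot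
  haveI : Fact ℓ.Prime := ⟨hℓP⟩
  have hℓ0 : (ℓ : ℤ) ≠ 0 := by exact_mod_cast hℓP.ne_zero
  -- `k = ℓᵃ·m`, `ℓ ∤ m`, `1 ≤ a ≤ 5`, `a` even
  set a : ℕ := padicValInt ℓ k with ha
  obtain ⟨m, hkm⟩ : ∃ m : ℤ, k = (ℓ : ℤ) ^ a * m := ha ▸ padicValInt_dvd k
  have hℓm : ¬ (ℓ : ℤ) ∣ m := by
    rintro ⟨m', rfl⟩
    have hdvd : (ℓ : ℤ) ^ (a + 1) ∣ k := ⟨m', by rw [hkm]; ring⟩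
    rcases (padicValInt_dvd_iff (p := ℓ) (a + 1) k).mp hdvd with h | h
    · exact hk h
    · omega
  have ha1 : 1 ≤ a := by
    rcases (padicValInt_dvd_iff (p := ℓ) 1 k).mp (by simpa using hℓk) with h | h
    · exact absurd h hk
    · exact h
  have ha5 : a ≤ 5 := by
    by_contra h5
    exact h6 ℓ hℓP hℓ1 (dvd_trans (pow_dvd_pow (ℓ : ℤ) (by omega)) (ha ▸ padicValInt_dvd k))
  have hdiv : k / (ℓ : ℤ) ^ a = m := by
    rw [hkm, Int.mul_ediv_cancel_left _ (pow_ne_zero _ hℓ0)]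
  rw [hdiv] at hsq
  have haeven : Even a := Nat.not_odd_iff_even.mp heven
  rw [hkm] at hW
  obtain ⟨hbad, hQ⟩ := vWitness_of_mordell_model W hℓ1 hℓm ha1 ha5 haeven hsq hW
  exact ⟨ℓ, ⟨hℓP⟩, hℓ1, hbad, hQ⟩

/-- **THE AWAY BINDER ⟺ THE CONGRUENCE** (any elliptic model `W` of `y² = x³ + k`, `k ≠ 0`
sixth-power-free at the primes `ℓ ≡ 1 (mod 3)` — e.g. the sixth-power-free normal form of the class):
ty2's away binder `hℓ` (no `ℚ_ℓ`-rational `3`-torsion at any bad `ℓ ≠ 3` with `√−3 ∈ ℚ_ℓ`) holds iff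
for every prime `ℓ ≡ 1 (mod 3)` dividing `k`, `v_ℓ(k)` is odd or `k/ℓ^{v_ℓ(k)}` is a non-residue
mod `ℓ`. So regime N vs regime V of a `j = 0` class is a decidable congruence on `k`.
[cite: SilvermanAEC2009, Exercise 3.7 and VII.5 Prop. 5.1] [cite: SilvermanATAEC1994, IV.9.4 and Table 4.1]
[cite: Serre1973, Ch. II §3.3 Thm 3] -/
theorem away_binder_iff_congruence_of_sixthPowerFree (W : WeierstrassCurve ℚ) [W.IsElliptic]
    {C : VariableChange ℚ} {k : ℤ} (hk : k ≠ 0) (hW : C • W = mordellCurve ((k : ℤ) : ℚ))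
    (h6 : ∀ ℓ : ℕ, ℓ.Prime → ℓ % 3 = 1 → ¬ (ℓ : ℤ) ^ 6 ∣ k) :
    (∀ (ℓ : ℕ) [Fact ℓ.Prime], ℓ ≠ 3 → (∃ y : ℚ_[ℓ], y ^ 2 = -3) → ¬ Good W ℓ →
        ∀ Q : (W.baseChange ℚ_[ℓ]).toAffine.Point, (3 : ℕ) • Q = 0 → Q = 0) ↔
      (∀ ℓ : ℕ, ℓ.Prime → (ℓ : ℤ) ∣ k → ℓ % 3 = 1 →
        Odd (padicValInt ℓ k) ∨ ¬ IsSquare (((k / (ℓ : ℤ) ^ padicValInt ℓ k : ℤ)) : ZMod ℓ)) := by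
  refine ⟨fun hℓ => ?_, away_binder_of_mordell_model hk hW⟩
  by_contra hnot
  obtain ⟨ℓ, hℓF, hℓ1, hbad, Q, hQ3, hQ0⟩ := exists_vWitness_of_not_congruence W hk hW h6 hnot
  have hℓP : ℓ.Prime := hℓF.out
  have h2 := hℓP.two_le
  have hℓ3 : ℓ ≠ 3 := by omega
  exact hQ0 (hℓ ℓ hℓ3 (exists_sq_eq_neg_three_padic hℓ1) hbad Q hQ3)

/-- **Regime letter N is a pair of congruences (both directions).** For an elliptic model `W` of
`y² = x³ + k`, `k = 3ᵃ·m` (`3 ∤ m`) sixth-power-free at the primes `ℓ ≡ 1 (mod 3)`: ALL THREE local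
binders of ty2's O11@3 consumer hold — `W(ℚ₃)[3] = 0`, `W^{(−3)}(ℚ₃)[3] = 0`, and the away binder — iff
(`a` even `∧ m ≡ 2` or `a` odd `∧ m ≡ 1 (mod 3)`) and the away congruence. (p546152 + the previous
theorem.) [cite: SilvermanAEC2009, Exercise 3.7] [cite: Serre1973, Ch. II §3.3 Thm 3] -/
theorem regimeN_iff_congruences (W : WeierstrassCurve ℚ) [W.IsElliptic] {C : VariableChange ℚ}
    {a : ℕ} {m : ℤ} (hm : ¬ (3 : ℤ) ∣ m)
    (hW : C • W = mordellCurve ((((3 : ℤ) ^ a * m : ℤ)) : ℚ))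
    (h6 : ∀ ℓ : ℕ, ℓ.Prime → ℓ % 3 = 1 → ¬ (ℓ : ℤ) ^ 6 ∣ (3 : ℤ) ^ a * m) :
    (((∀ Q : (W.baseChange ℚ_[3]).toAffine.Point, (3 : ℕ) • Q = 0 → Q = 0) ∧
      (∀ Q : ((W.quadraticTwist (-3 : ℚ)).baseChange ℚ_[3]).toAffine.Point,
        (3 : ℕ) • Q = 0 → Q = 0)) ∧
     (∀ (ℓ : ℕ) [Fact ℓ.Prime], ℓ ≠ 3 → (∃ y : ℚ_[ℓ], y ^ 2 = -3) → ¬ Good W ℓ →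
        ∀ Q : (W.baseChange ℚ_[ℓ]).toAffine.Point, (3 : ℕ) • Q = 0 → Q = 0)) ↔
    (((Even a ∧ (m : ZMod 3) = 2) ∨ (Odd a ∧ (m : ZMod 3) = 1)) ∧
      (∀ ℓ : ℕ, ℓ.Prime → (ℓ : ℤ) ∣ (3 : ℤ) ^ a * m → ℓ % 3 = 1 →
        Odd (padicValInt ℓ ((3 : ℤ) ^ a * m)) ∨
          ¬ IsSquare (((((3 : ℤ) ^ a * m) / (ℓ : ℤ) ^ padicValInt ℓ ((3 : ℤ) ^ a * m) : ℤ)) :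
            ZMod ℓ))) := by
  have hm0 : m ≠ 0 := fun h => hm (h ▸ dvd_zero 3)
  have hk : (3 : ℤ) ^ a * m ≠ 0 := mul_ne_zero (pow_ne_zero _ (by norm_num)) hm0
  rw [JZeroThree.noThreeTorsion_pair_iff_of_mordell_model W hm hW,
    away_binder_iff_congruence_of_sixthPowerFree W hk hW h6]

end Summit.BirchSwinnertonDyer.BirchSwinnertonDyer.Theorems.PrintCFram

end
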